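import Summits.NavierStokesRegularity.NavierStokesRegularity.Theorems.TypeIliouvilleNoTypeII.Negative.NSISuperCascadeNoAtom
import Summits.NavierStokesRegularity.NavierStokesRegularity.Theorems.TypeIliouvilleNoTypeII.Negative.NSISuperCascadeReach
import HarnessLib

/-!
# The Type-II portrait of the super-similar NSI cascades: exact two-sided rate, atom-free

Negative-lane support file for `stmt-NavierStokesRegularity-0056`
(`Summit.NavierStokesRegularity.NavierStokesRegularity.Theses.TypeILiouville.TypeIliouvilleNoTypeII`),
model-class REACH of the counterexample family `glueG` (kill-kit M2′); assembles
`NSIBlockStrictGain.lean` (strict cap, `rateExp_mem_Ioo`, `norm_glueG_le_rate`),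
`NSISuperCascadeNoAtom.lean` (`IsSuperBlock.tendsto_lintegral_norm_sq_glueG`) and
`NSISuperCascadeReach.lean` (`exists_isSuperBlock_rateExp_eq`):

* `IsSuperBlock.typeII_portrait` — for every super-block: the EXPLICIT exponent
  `β = log_{σ⁻²} a ∈ (1/2, 3/5)`, the two-sided rate `c (T₀−t)^{−β} ≤ sup|𝔲(t)| ≤ C (T₀−t)^{−β}` on
  `[0, T₀)` (`norm_glueG_le_rate` and the lower bound of `exists_rate_glueG` with `β` exposed,
  `0 < c ≤ C`), and `∫|𝔲(t)|² → 0` at `T₀`;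
* `exists_weakNSI_blowup_exact_rate` — **headline of the M2′ dossier**: there is
  `β₀ ∈ (1/2, 3/5)` such that for EVERY `β ∈ (1/2, β₀]` a compactly supported weak solution of the
  Navier–Stokes inequality (all `ν ∈ [0, ν₀]`, smooth slices) blows up at some `T₀ > 0` at the EXACT
  two-sided rate `(T₀ − t)^{−β}` with `∫|u(t)|² → 0` — the shape of the barrier
  `NSITypeIIBlowup` with the rate prescribed and exact and the energy clause added.

K3 usage (kill-kit v1.2): a candidate `NoTypeII` mechanism insensitive to the NS identity is refuted
by M2′ iff its claimed obstruction covers some `β ∈ (1/2, β₀]` (length exponent `1 − β`); rates in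
`(β₀, 3/5)` are open (O3), `β ≥ 3/5` and energy atoms are outside the class. WHAT THIS IS NOT: not a
statement about Navier–Stokes solutions.

## References

* W. S. Ożański, arXiv:1709.00602 (2017), §2, §5. [`Ozanski2017NSISingular`]
-/

noncomputable section

open MeasureTheory Set Function Filter Topology TopologicalSpace Metric Module
open scoped ENNReal

set_option linter.dupNamespace false

namespace Summit.NavierStokesRegularity.NavierStokesRegularity.Theorems.TypeIliouvilleNoTypeIINegative

open Literature.Analysis.FluidPDE Literature.Barriers.NavierStokesRegularity
open Literature.Barriers.NavierStokesRegularity.Scheffer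

namespace IsSuperBlock

variable {T ν₀ τ σ a : ℝ} {z : EuclideanSpace ℝ (Fin 3)} {G : Set (EuclideanSpace ℝ (Fin 3))}
  {u : ℝ → EuclideanSpace ℝ (Fin 3) → EuclideanSpace ℝ (Fin 3)}

/-- **The Type-II portrait of a super-similar NSI cascade** (one citation for kill-kit lines):
with the EXPLICIT exponent `β = log_{σ⁻²} a ∈ (1/2, 3/5)` there are `0 < c ≤ C` with
`c (T₀ − t)^{−β} ≤ sup_x |𝔲(t,x)|` (attained at some point) and `|𝔲(t,x)| ≤ C (T₀ − t)^{−β}` for all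
`t ∈ [0, T₀)`, and the slice energies tend to `0` at `T₀` (`tendsto_lintegral_norm_sq_glueG` of
`NSISuperCascadeNoAtom`): a mildly Type-II, exactly-`β`-rate, atom-free blow-up.
[cite: Ozanski2017NSISingular, §2.1 (p. 6)] -/
theorem typeII_portrait (h : IsSuperBlock T ν₀ τ σ a z G u) :
    Real.logb ((σ⁻¹) ^ 2) a ∈ Ioo (1 / 2 : ℝ) (3 / 5) ∧
    (∃ c C : ℝ, 0 < c ∧ c ≤ C ∧ ∀ t ∈ Ico 0 (blowupTime T σ),
      (∃ x, c * (blowupTime T σ - t) ^ (-Real.logb ((σ⁻¹) ^ 2) a) ≤ ‖glueG T σ τ a z u t x‖) ∧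
      ∀ x, ‖glueG T σ τ a z u t x‖ ≤ C * (blowupTime T σ - t) ^ (-Real.logb ((σ⁻¹) ^ 2) a)) ∧
    Tendsto (fun t => ∫⁻ x, ‖glueG T σ τ a z u t x‖ₑ ^ 2) (𝓝 (blowupTime T σ)) (𝓝 0) := by
  refine ⟨h.rateExp_mem_Ioo, ?_, h.tendsto_lintegral_norm_sq_glueG⟩
  have hσ₀ := h.σ_pos
  have hσ₁ := h.σ_lt_one
  have ha : 0 < a := h.gain_pos
  obtain ⟨M, hM, hup⟩ := norm_glueG_le_rate h.block hσ₀ hσ₁ h.one_lt_gain.le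
  obtain ⟨m, hm, hmu⟩ := exists_pos_forall_exists_le_norm h.block
  -- the base `b = σ⁻² > 1` and the exponent `β = log_b a`
  set b : ℝ := (σ⁻¹) ^ 2 with hb
  have hσinv : 1 < σ⁻¹ := (one_lt_inv₀ hσ₀).2 hσ₁
  have hb1 : 1 < b := by rw [hb]; nlinarith
  have hb0 : 0 < b := one_pos.trans hb1
  set β : ℝ := Real.logb b a with hβ
  have hbβ : b ^ β = a := Real.rpow_logb hb0 hb1.ne' ha
  have hβ0 : 0 < β := by linarith [h.rateExp_mem_Ioo.1]
  have hT₀ : 0 < blowupTime T σ := div_pos h.T_pos (by nlinarith)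
  have hT0mem : (0 : ℝ) ∈ Ico 0 (blowupTime T σ) := ⟨le_rfl, hT₀⟩
  -- the lower constant `c = m a⁻¹ T₀^β`; `c ≤ M` by comparing both bounds at `t = 0`
  set c : ℝ := m * a⁻¹ * blowupTime T σ ^ β with hc
  have hc0 : 0 < c := by positivity
  have hlow : ∀ t ∈ Ico 0 (blowupTime T σ), ∃ x,
      c * (blowupTime T σ - t) ^ (-β) ≤ ‖glueG T σ τ a z u t x‖ := by
    intro t ht
    obtain ⟨j, hj⟩ := exists_mem_Ico_switchTime hσ₀ hσ₁ ht.1 ht.2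
    have hloc : (σ⁻¹) ^ (2 * j) * (t - switchTime T σ j) ∈ Icc 0 T :=
      localTime_mem_Icc hσ₀ (Ico_subset_Icc_self hj)
    obtain ⟨y, hy⟩ := hmu _ hloc
    refine ⟨(1 - τ)⁻¹ • z + τ ^ j • (y - (1 - τ)⁻¹ • z), ?_⟩
    rw [glueG_eq_pieceG h.T_pos hσ₀ τ a z u hj, pieceG_apply, add_sub_cancel_left, smul_smul, ← mul_pow,
      inv_mul_cancel₀ h.τ_pos.ne', one_pow, one_smul, add_sub_cancel, norm_smul,
      Real.norm_of_nonneg (pow_nonneg ha.le _)]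
    have hσ2 : σ ^ 2 ≠ 1 := (pow_lt_one₀ hσ₀.le hσ₁ two_ne_zero).ne
    have hgap : blowupTime T σ - switchTime T σ (j + 1) = σ ^ (2 * (j + 1)) * blowupTime T σ :=
      blowupTime_sub_switchTime T hσ2 (j + 1)
    have hpos1 : 0 < σ ^ (2 * (j + 1)) * blowupTime T σ := by positivity
    have hle1 : σ ^ (2 * (j + 1)) * blowupTime T σ ≤ blowupTime T σ - t := by
      rw [← hgap]; linarith [hj.2]
    have hanti : (blowupTime T σ - t) ^ (-β) ≤ (σ ^ (2 * (j + 1)) * blowupTime T σ) ^ (-β) :=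
      Real.rpow_le_rpow_of_nonpos hpos1 hle1 (by linarith)
    have hpow : (σ ^ (2 * (j + 1))) ^ (-β) = a ^ (j + 1) := by
      have e1 : σ ^ (2 * (j + 1)) = (b ^ (j + 1))⁻¹ := by
        rw [hb, ← pow_mul, inv_pow, inv_inv]
      rw [e1, Real.inv_rpow (pow_nonneg hb0.le _), Real.rpow_neg (pow_nonneg hb0.le _), inv_inv,
        ← Real.rpow_natCast b (j + 1), ← Real.rpow_mul hb0.le, mul_comm, Real.rpow_mul hb0.le, hbβ,
        Real.rpow_natCast]
    have hkey : (σ ^ (2 * (j + 1)) * blowupTime T σ) ^ (-β) =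
        a ^ (j + 1) * (blowupTime T σ) ^ (-β) := by
      rw [Real.mul_rpow (pow_nonneg hσ₀.le _) hT₀.le, hpow]
    calc m * a⁻¹ * blowupTime T σ ^ β * (blowupTime T σ - t) ^ (-β)
        ≤ m * a⁻¹ * blowupTime T σ ^ β * (a ^ (j + 1) * (blowupTime T σ) ^ (-β)) := by
          rw [← hkey]; exact mul_le_mul_of_nonneg_left hanti (by positivity)
      _ = a ^ j * m := by
          rw [Real.rpow_neg hT₀.le, pow_succ]
          field_simp
      _ ≤ a ^ j * ‖u ((σ⁻¹) ^ (2 * j) * (t - switchTime T σ j)) y‖ :=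
          mul_le_mul_of_nonneg_left hy (pow_nonneg ha.le _)
  have hcM : c ≤ M := by
    obtain ⟨x, hx⟩ := hlow 0 hT0mem
    have h2 := hup 0 hT0mem x
    have hp : 0 < (blowupTime T σ - 0) ^ (-β) := Real.rpow_pos_of_pos (by simpa using hT₀) _
    exact le_of_mul_le_mul_right (hx.trans h2) hp
  exact ⟨c, M, hc0, hcM, fun t ht => ⟨hlow t ht, hup t ht⟩⟩

end IsSuperBlock

/-- **NSI blow-up at every prescribed rate `β ∈ (1/2, β₀]`, atom-free** (headline of the M2′
dossier; shape of `NSITypeIIBlowup` with the rate made EXACT and two-sided and the energy clause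
added; `𝓝 T₀` two-sided since the field vanishes past `T₀`): there is `β₀ ∈ (1/2, 3/5)` such that for every `β ∈ (1/2, β₀]` some `ν₀ > 0`, compact `K` and
field `u` with smooth slices supported in `K`, a weak solution of the Navier–Stokes inequality for
EVERY `ν ∈ [0, ν₀]`, blow up at a time `T₀ > 0` with `c (T₀ − t)^{−β} ≤ sup|u(t)| ≤ C (T₀ − t)^{−β}` on
`[0, T₀)` and `∫|u(t)|² → 0` as `t ↑ T₀` (`exists_isSuperBlock_rateExp_eq` + `typeII_portrait` +
`isWeakNSISolution_glueG`). [cite: Ozanski2017NSISingular, §2, §5] -/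
theorem exists_weakNSI_blowup_exact_rate :
    ∃ β₀ : ℝ, 1 / 2 < β₀ ∧ β₀ < 3 / 5 ∧ ∀ β ∈ Ioc (1 / 2 : ℝ) β₀,
      ∃ ν₀ : ℝ, 0 < ν₀ ∧
        ∃ (K : Set (EuclideanSpace ℝ (Fin 3)))
          (v : ℝ → EuclideanSpace ℝ (Fin 3) → EuclideanSpace ℝ (Fin 3))
          (p : ℝ → EuclideanSpace ℝ (Fin 3) → ℝ),
          IsCompact K ∧ (∀ ν ∈ Icc (0 : ℝ) ν₀, IsWeakNSISolution ν v p) ∧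
          (∀ t : ℝ, 0 ≤ t → ContDiff ℝ ((⊤ : ℕ∞) : WithTop ℕ∞) (v t) ∧ tsupport (v t) ⊆ K) ∧
          ∃ T₀ : ℝ, 0 < T₀ ∧
            (∃ c C : ℝ, 0 < c ∧ c ≤ C ∧ ∀ t ∈ Ico 0 T₀,
              (∃ x, c * (T₀ - t) ^ (-β) ≤ ‖v t x‖) ∧ ∀ x, ‖v t x‖ ≤ C * (T₀ - t) ^ (-β)) ∧
            Tendsto (fun t => ∫⁻ x, ‖v t x‖ₑ ^ 2) (𝓝 T₀) (𝓝 0) := by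
  obtain ⟨β₀, hβ₀, hβ₀', hreach⟩ := exists_isSuperBlock_rateExp_eq
  refine ⟨β₀, hβ₀, hβ₀', fun β hβ => ?_⟩
  obtain ⟨T, ν₀, τ, σ, a, z, G, u, hS, hβeq⟩ := hreach β hβ
  obtain ⟨-, hrate, hE⟩ := hS.typeII_portrait
  rw [hβeq] at hrate
  have hT₀ : 0 < blowupTime T σ := div_pos hS.T_pos (by nlinarith [hS.σ_sq_lt_one])
  exact ⟨ν₀, hS.block.ν₀_pos, G, glueG T σ τ a z u, fun t => normalisedPressure (glueG T σ τ a z u t),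
    hS.block.isCompact, fun ν hν => hS.isWeakNSISolution_glueG hν,
    fun t _ => ⟨hS.contDiff_glueG_slice t, hS.tsupport_glueG_slice_subset t⟩,
    blowupTime T σ, hT₀, hrate, hE⟩

end Summit.NavierStokesRegularity.NavierStokesRegularity.Theorems.TypeIliouvilleNoTypeIINegative

end
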